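import Summits.AnomalousDissipation.AnomalousDissipation.Theorems.SoloInformedWitnessConstraints
import Literature.Analysis.FluidPDE.LongTimeAverageShift
import Literature.Analysis.FluidPDE.LongTimeAverageNonneg
import Literature.Dynamics.Ergodic.BirkhoffErgodicTheoremProofs
import Mathlib.Analysis.SpecificLimits.Basic
import HarnessLib

/-!
# The ensemble (statistically stationary) zeroth law implies the zeroth law (solo-informed)

The summit `AnomalousDissipation` (= `Literature.Turb.ZerothLaw`) is a statement about the
LONG-TIME MEANS of INDIVIDUAL Leray–Hopf trajectories: one fixed smooth force `f`, viscosities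
`ν_j → 0`, and for each `j` ONE global Leray–Hopf solution `u_j` with `⟨‖u_j‖₂²⟩ ≤ E` and
`⟨ν_j‖∇u_j‖₂²⟩ ≥ ε`.  The physically customary formulation of the zeroth law is instead
STATISTICAL: for each `ν_j` a time-stationary statistical state (an invariant measure / a
stationary statistical solution in the sense of Foias–Prodi / Vishik–Fursikov / Foias–Manley–
Rosa–Temam) whose ENSEMBLE-mean energy is bounded and whose ENSEMBLE-mean dissipation rate is
bounded below, uniformly in `j`.

This file proves, at kernel level, that the statistical formulation is NOT weaker than the
summit: a shift-stationary ensemble of global Leray–Hopf trajectories (for the fixed steady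
force `f`) with mean window-energy `≤ E` and mean window-dissipation `≥ ε` CONTAINS a single
trajectory whose long-time means satisfy `⟨‖u‖₂²⟩ ≤ (4‖f‖₂E/ε)² + 1` and `⟨ν‖∇u‖₂²⟩ ≥ ε/2`
(`exists_trajectory_of_stationaryEnsemble`), and hence a vanishing-viscosity family of such
ensembles for ONE force gives `AnomalousDissipation` (`anomalousDissipation_of_stationaryEnsembles`).

The ensemble is modelled abstractly and minimally, by explicit hypotheses: a probability space
`(Ω, P)`, a measure-preserving map `θ` (the unit time shift), and a trajectory map
`U : Ω → ℝ → T³ → ℝ³` with `U (θ ω) t = U ω (t + 1)` for `t ≥ 0`, such that `P`-a.e. `U ω` is a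
global Leray–Hopf solution driven by `f` (from some `L²` datum), and the unit-window energy and
dissipation `energyObs U ω = ∫₀¹‖U ω t‖₂² dt`, `dissipationObs ν U ω = ∫₀¹ ν‖∇U ω t‖₂² dt` are
`P`-integrable.  (A stationary statistical solution carried by trajectory space — Foias–Manley–
Rosa–Temam 2001, Ch. IV §1 — with `θ` the shift is the model; nothing about its construction is
assumed or used.)

Proof: Birkhoff's pointwise ergodic theorem (in-tree, PROVED: `birkhoff_ergodic_theorem_holds`)
for the two window observables gives a.s. convergence of the integer-time Cesàro means; for a
nonnegative locally integrable integrand this upgrades to convergence of `T⁻¹∫₀ᵀ`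
(`tendsto_timeMean_of_tendsto_nat`), so the `limsup` means of the summit are genuine limits
`e*`, `d*` with `∫ e* ≤ E`, `∫ d* ≥ ε`; the pathwise bound `d* ≤ ‖f‖₂ √e*` (in-tree
`lerayHopf_meanDissipation_le_norm_mul_sqrt_meanEnergy`) gives `∫ (d* − (‖f‖₂/√E′) e*) ≥ 3ε/4`, and
a trajectory where that integrand exceeds `ε/2` has `d* ≥ ε/2` and `e* ≤ E′`.

Role (solo-informed wall, census r9): the "invariant-measure door" is thereby typed exactly —
what it lacks is not the passage measure → trajectory (free, this file) but an ENSEMBLE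
dissipation floor uniform in `ν` for a fixed force, which is the summit's difficulty verbatim.

References: Foias–Manley–Rosa–Temam, *Navier–Stokes Equations and Turbulence* (CUP 2001), Ch. IV
§1–3 [FoiasManleyRosaTemam2001]; Cheskidov–Doering–Petrov, JFM 2007, (11), (17)
[CheskidovDoeringPetrov2006]; Dajani–Kalle, *A First Course in Ergodic Theory*, Thm 3.1.1 [DajaniKalle2021].
-/

noncomputable section

open MeasureTheory Filter Topology Set
open scoped ENNReal NNReal

namespace Summit.AnomalousDissipation.AnomalousDissipation.Theorems

open Literature.Analysis.FunctionSpaces Literature.Analysis.FluidPDE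

universe u

/-- The physical flat unit torus `T³ = (ℝ/ℤ)³` (local notation). -/
local notation "𝕋³" => UnitAddTorus (Fin 3)
/-- Velocity values on `T³` (local notation). -/
local notation "E³" => EuclideanSpace ℝ (Fin 3)

/-! ### Cesàro means along the integers control Cesàro means along the reals -/

/-- **Integer-time Cesàro convergence implies real-time Cesàro convergence** for a nonnegative,
locally integrable integrand: if `n⁻¹∫₀ⁿ φ → L` along `n ∈ ℕ` then `T⁻¹∫₀ᵀ φ → L` along `T ∈ ℝ`
(squeeze between `T⁻¹∫₀^{⌊T⌋} φ` and `T⁻¹∫₀^{⌊T⌋+1} φ`, both `→ L` since `⌊T⌋/T → 1`). [folklore] -/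
theorem tendsto_timeMean_of_tendsto_nat {φ : ℝ → ℝ} (hφ : ∀ t, 0 ≤ φ t)
    (hint : ∀ a b, 0 ≤ a → a ≤ b → IntervalIntegrable φ volume a b) {L : ℝ}
    (h : Tendsto (fun n : ℕ => timeMean φ n) atTop (𝓝 L)) :
    Tendsto (timeMean φ) atTop (𝓝 L) := by
  have hmono : ∀ s t : ℝ, 0 ≤ s → s ≤ t →
      ∫ x in (0 : ℝ)..s, φ x ≤ ∫ x in (0 : ℝ)..t, φ x := fun s t hs hst =>
    intervalIntegral.integral_mono_interval le_rfl hs hst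
      (Eventually.of_forall fun x => hφ x) (hint 0 t le_rfl (hs.trans hst))
  have htm : ∀ T : ℝ, timeMean φ T = T⁻¹ * ∫ x in (0 : ℝ)..T, φ x := fun T => rfl
  have hkey : ∀ n : ℕ, n ≠ 0 → ∀ T : ℝ,
      (n : ℝ) / T * timeMean φ n = T⁻¹ * ∫ x in (0 : ℝ)..(n : ℝ), φ x := by
    intro n hn T
    have hn' : (n : ℝ) ≠ 0 := Nat.cast_ne_zero.2 hn
    rw [htm]
    calc (n : ℝ) / T * ((n : ℝ)⁻¹ * ∫ x in (0 : ℝ)..(n : ℝ), φ x)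
        = ((n : ℝ) * (n : ℝ)⁻¹) * (T⁻¹ * ∫ x in (0 : ℝ)..(n : ℝ), φ x) := by ring
      _ = T⁻¹ * ∫ x in (0 : ℝ)..(n : ℝ), φ x := by rw [mul_inv_cancel₀ hn', one_mul]
  -- the lower comparison function tends to `L`
  have hlow : Tendsto (fun T : ℝ => (⌊T⌋₊ : ℝ) / T * timeMean φ (⌊T⌋₊ : ℕ)) atTop (𝓝 L) := by
    have := (tendsto_nat_floor_div_atTop (R := ℝ)).mul (h.comp tendsto_nat_floor_atTop)
    rw [one_mul] at this
    exact this
  -- the upper comparison function tends to `L`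
  have hup : Tendsto (fun T : ℝ => ((⌊T⌋₊ : ℝ) + 1) / T * timeMean φ ((⌊T⌋₊ : ℝ) + 1))
      atTop (𝓝 L) := by
    have h1 : Tendsto (fun T : ℝ => ((⌊T⌋₊ : ℝ) + 1) / T) atTop (𝓝 1) := by
      have := (tendsto_nat_floor_div_atTop (R := ℝ)).add tendsto_inv_atTop_zero
      rw [add_zero] at this
      refine this.congr' (Eventually.of_forall fun T => ?_)
      simp only [add_div, one_div]
    have h2 : Tendsto (fun T : ℝ => timeMean φ ((⌊T⌋₊ : ℝ) + 1)) atTop (𝓝 L) := by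
      have := h.comp ((tendsto_add_atTop_nat 1).comp
        (tendsto_nat_floor_atTop : Tendsto (fun x : ℝ => ⌊x⌋₊) atTop atTop))
      refine this.congr' (Eventually.of_forall fun T => ?_)
      simp only [Function.comp_apply, Nat.cast_add_one]
    have := h1.mul h2
    rw [one_mul] at this
    exact this
  refine tendsto_of_tendsto_of_tendsto_of_le_of_le' hlow hup ?_ ?_
  · filter_upwards [eventually_ge_atTop (1 : ℝ)] with T hT
    have hT0 : 0 < T := by linarith
    have hn : ⌊T⌋₊ ≠ 0 := (Nat.floor_pos.2 hT).ne'
    rw [hkey _ hn, htm]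
    exact mul_le_mul_of_nonneg_left (hmono _ _ (Nat.cast_nonneg _) (Nat.floor_le hT0.le))
      (inv_nonneg.2 hT0.le)
  · filter_upwards [eventually_ge_atTop (1 : ℝ)] with T hT
    have hT0 : 0 < T := by linarith
    have hk := hkey (⌊T⌋₊ + 1) (Nat.succ_ne_zero _) T
    push_cast at hk
    rw [hk, htm]
    exact mul_le_mul_of_nonneg_left (hmono _ _ hT0.le (Nat.lt_floor_add_one T).le)
      (inv_nonneg.2 hT0.le)

/-- For a nonnegative locally integrable integrand whose integer-time Cesàro means converge to `L`,
the `limsup` long-time mean `longTimeAvgSup` IS `L`. [folklore] -/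
theorem longTimeAvgSup_eq_of_tendsto_nat {φ : ℝ → ℝ} (hφ : ∀ t, 0 ≤ φ t)
    (hint : ∀ a b, 0 ≤ a → a ≤ b → IntervalIntegrable φ volume a b) {L : ℝ}
    (h : Tendsto (fun n : ℕ => timeMean φ n) atTop (𝓝 L)) :
    longTimeAvgSup φ = L :=
  (tendsto_timeMean_of_tendsto_nat hφ hint h).limsup_eq

/-! ### Shift-equivariant trajectory observables: Cesàro means are Birkhoff averages -/

section Ensemble

variable {Ω : Type u}

/-- Iterating the unit-shift equivariance `Φ (θ ω) t = Φ ω (t + 1)` (`t ≥ 0`):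
`Φ (θ^[k] ω) t = Φ ω (t + k)`. [folklore] -/
theorem shift_iterate {X : Type*} {θ : Ω → Ω} {Φ : Ω → ℝ → X}
    (hΦ : ∀ ω t, 0 ≤ t → Φ (θ ω) t = Φ ω (t + 1)) (k : ℕ) :
    ∀ ω t, 0 ≤ t → Φ (θ^[k] ω) t = Φ ω (t + k) := by
  induction k with
  | zero => intro ω t _; simp
  | succ k ih =>
    intro ω t ht
    rw [Function.iterate_succ_apply, ih (θ ω) t ht, hΦ ω (t + k) (by positivity)]
    congr 1
    push_cast
    ring

/-- **Integer-time Cesàro means of an equivariant trajectory observable are Birkhoff averages**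
of its unit-window integral: `n⁻¹∫₀ⁿ Φ_ω = n⁻¹ ∑_{k<n} ∫₀¹ Φ_{θᵏω}`. [folklore] -/
theorem timeMean_nat_eq_birkhoffAverage {θ : Ω → Ω} {Φ : Ω → ℝ → ℝ}
    (hΦ : ∀ ω t, 0 ≤ t → Φ (θ ω) t = Φ ω (t + 1)) {ω : Ω}
    (hint : ∀ a b, 0 ≤ a → a ≤ b → IntervalIntegrable (Φ ω) volume a b) (n : ℕ) :
    timeMean (Φ ω) n = birkhoffAverage ℝ θ (fun ω' => ∫ t in (0 : ℝ)..1, Φ ω' t) n ω := by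
  have hiter := shift_iterate hΦ
  have hobs : ∀ k : ℕ, (∫ t in (0 : ℝ)..1, Φ (θ^[k] ω) t) =
      ∫ t in (k : ℝ)..((k + 1 : ℕ) : ℝ), Φ ω t := by
    intro k
    rw [intervalIntegral.integral_congr (g := fun t => Φ ω (t + k)) ?_]
    · rw [intervalIntegral.integral_comp_add_right (fun t => Φ ω t) (k : ℝ)]
      have e1 : (0 : ℝ) + k = k := zero_add _
      have e2 : (1 : ℝ) + k = ((k + 1 : ℕ) : ℝ) := by push_cast; ring
      rw [e1, e2]
    · intro t ht
      rw [uIcc_of_le zero_le_one] at ht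
      exact hiter k ω t ht.1
  have hint' : ∀ k < n, IntervalIntegrable (Φ ω) volume (k : ℝ) ((k + 1 : ℕ) : ℝ) :=
    fun k _ => hint _ _ (Nat.cast_nonneg k) (by push_cast; linarith)
  simp only [birkhoffAverage, birkhoffSum, smul_eq_mul, hobs]
  rw [intervalIntegral.sum_integral_adjacent_intervals hint', Nat.cast_zero]
  rfl

variable [MeasurableSpace Ω]

/-- **Birkhoff for trajectory observables.**  On a probability space with a measure-preserving
map `θ`, let `Φ : Ω → ℝ → ℝ` be nonnegative, unit-shift equivariant (`Φ (θ ω) t = Φ ω (t+1)`,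
`t ≥ 0`), a.s. locally integrable in `t`, with integrable unit-window integral `∫₀¹ Φ_ω`.  Then
there is an integrable `Φ*` with `∫ Φ* dP = ∫ (∫₀¹ Φ_ω) dP` such that for a.e. `ω` the REAL-time
Cesàro means converge, `T⁻¹∫₀ᵀ Φ_ω → Φ*(ω)` (Birkhoff along integer times — in-tree
`birkhoff_ergodic_theorem_holds` — upgraded by `tendsto_timeMean_of_tendsto_nat`).
[cite: DajaniKalle2021, Thm 3.1.1] -/
theorem ae_tendsto_timeMean_of_measurePreserving (P : Measure Ω) [IsProbabilityMeasure P]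
    {θ : Ω → Ω} (hθ : MeasurePreserving θ P P) {Φ : Ω → ℝ → ℝ}
    (hΦ : ∀ ω t, 0 ≤ t → Φ (θ ω) t = Φ ω (t + 1)) (hΦ0 : ∀ ω t, 0 ≤ Φ ω t)
    (hint : ∀ᵐ ω ∂P, ∀ a b, 0 ≤ a → a ≤ b → IntervalIntegrable (Φ ω) volume a b)
    (hobs : Integrable (fun ω => ∫ t in (0 : ℝ)..1, Φ ω t) P) :
    ∃ Φstar : Ω → ℝ, Integrable Φstar P ∧
      ∫ ω, Φstar ω ∂P = ∫ ω, (∫ t in (0 : ℝ)..1, Φ ω t) ∂P ∧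
      ∀ᵐ ω ∂P, Tendsto (timeMean (Φ ω)) atTop (𝓝 (Φstar ω)) := by
  obtain ⟨Φstar, hI, -, hmean, hae⟩ :=
    Literature.Dynamics.Ergodic.birkhoff_ergodic_theorem_holds P θ hθ _ hobs
  refine ⟨Φstar, hI, hmean, ?_⟩
  filter_upwards [hae, hint] with ω hω hω'
  refine tendsto_timeMean_of_tendsto_nat (hΦ0 ω) hω' ?_
  refine hω.congr' (Eventually.of_forall fun n => ?_)
  exact (timeMean_nat_eq_birkhoffAverage hΦ hω' n).symm

/-! ### Stationary ensembles of Leray–Hopf trajectories -/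

/-- The unit-window kinetic energy of the trajectory labelled `ω`: `∫₀¹ ‖U ω t‖₂² dt`. [folklore] -/
def energyObs (U : Ω → ℝ → 𝕋³ → E³) (ω : Ω) : ℝ :=
  ∫ t in (0 : ℝ)..1, ∫ x, ‖U ω t x‖ ^ 2

/-- The unit-window energy dissipation of the trajectory labelled `ω`: `∫₀¹ ν‖∇U ω t‖₂² dt`
(spectral gradient norm, as in `meanDissipation`). [folklore] -/
def dissipationObs (ν : ℝ) (U : Ω → ℝ → 𝕋³ → E³) (ω : Ω) : ℝ :=
  ∫ t in (0 : ℝ)..1, ν * (Torus.eGradNormSq (U ω t)).toReal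

/-- Local integrability in time of `t ↦ ‖u(t)‖₂²` along a global Leray–Hopf solution. [folklore] -/
theorem lerayHopf_intervalIntegrable_energy {ν : ℝ} {F : ℝ → 𝕋³ → E³} {u₀ : 𝕋³ → E³}
    {u : ℝ → 𝕋³ → E³} (hu : Torus.IsGlobalLerayHopf ν F u₀ u) :
    ∀ a b, 0 ≤ a → a ≤ b → IntervalIntegrable (fun t => ∫ x, ‖u t x‖ ^ 2) volume a b :=
  fun _ _ ha hab => intervalIntegrable_of_forall_integrableOn_Ioc
    (fun _ hT => hu.integrableOn_integral_norm_sq hT) ha hab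

/-- Local integrability in time of `t ↦ ν‖∇u(t)‖₂²` (spectral, `toReal`) along a global
Leray–Hopf solution. [folklore] -/
theorem lerayHopf_intervalIntegrable_dissipation {ν : ℝ} {F : ℝ → 𝕋³ → E³} {u₀ : 𝕋³ → E³}
    {u : ℝ → 𝕋³ → E³} (hu : Torus.IsGlobalLerayHopf ν F u₀ u) :
    ∀ a b, 0 ≤ a → a ≤ b →
      IntervalIntegrable (fun t => ν * (Torus.eGradNormSq (u t)).toReal) volume a b := by
  intro a b ha hab
  refine intervalIntegrable_of_forall_integrableOn_Ioc (fun T hT => ?_) ha hab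
  have hLH := hu T hT
  exact ((integrableOn_Ioc_iff_integrableOn_Ioo).mpr (integrable_toReal_of_lintegral_ne_top
    hLH.aemeasurable_eGradNormSq hLH.lintegral_eGradNormSq_lt_top.ne)).const_mul ν

/-- `a ≤ √(a² + 1)` for every real `a`. [folklore] -/
theorem le_sqrt_sq_add_one (a : ℝ) : a ≤ Real.sqrt (a ^ 2 + 1) :=
  (le_abs_self a).trans <| by
    rw [← Real.sqrt_sq_eq_abs]
    exact Real.sqrt_le_sqrt (by linarith)

/-- **One good trajectory in a stationary ensemble.**  Let `f` be a smooth mean-zero steady force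
on `T³`, `ν > 0`, and let `(P, θ, U)` be a shift-stationary ensemble of Leray–Hopf trajectories
(`θ` measure preserving, `U` shift-equivariant, a.e. trajectory a global Leray–Hopf solution
driven by `f`, integrable unit-window energy and dissipation) with ensemble-mean unit-window
energy `≤ E` and ensemble-mean unit-window dissipation `≥ ε > 0`.
Then SOME trajectory of the ensemble is a global Leray–Hopf solution whose long-time means (the
`limsup` Cesàro means of the summit statement) satisfy `⟨‖u‖₂²⟩ ≤ (4‖f‖₂E/ε)² + 1` and
`⟨ν‖∇u‖₂²⟩ ≥ ε/2`.  (Birkhoff a.s. along trajectories; the pathwise bound `⟨ν‖∇u‖²⟩ ≤ ‖f‖₂⟨‖u‖²⟩^{1/2}`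
caps the dissipation of high-energy trajectories; Chebyshev-type selection.) [folklore] -/
theorem exists_trajectory_of_stationaryEnsemble {ν : ℝ} (hν : 0 < ν) {f : 𝕋³ → E³}
    (hf : Torus.IsSmooth f) (hmean : Torus.HasZeroMean f)
    {P : Measure Ω} [IsProbabilityMeasure P] {θ : Ω → Ω} (hθ : MeasurePreserving θ P P)
    {U : Ω → ℝ → 𝕋³ → E³} (hshift : ∀ ω t, 0 ≤ t → U (θ ω) t = U ω (t + 1))
    (hLH : ∀ᵐ ω ∂P, ∃ u₀ : 𝕋³ → E³, Torus.IsGlobalLerayHopf ν (fun _ => f) u₀ (U ω))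
    (hie : Integrable (energyObs U) P) (hid : Integrable (dissipationObs ν U) P)
    {E ε : ℝ} (hε : 0 < ε)
    (hE : ∫ ω, energyObs U ω ∂P ≤ E) (hεle : ε ≤ ∫ ω, dissipationObs ν U ω ∂P) :
    ∃ ω, (∃ u₀ : 𝕋³ → E³, Torus.IsGlobalLerayHopf ν (fun _ => f) u₀ (U ω)) ∧
      meanEnergy (U ω) ≤ (4 * Real.sqrt (∫ x, ‖f x‖ ^ 2) * E / ε) ^ 2 + 1 ∧
      ε / 2 ≤ meanDissipation ν (U ω) := by
  -- the two trajectory observables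
  set Φe : Ω → ℝ → ℝ := fun ω t => ∫ x, ‖U ω t x‖ ^ 2 with hΦe
  set Φd : Ω → ℝ → ℝ := fun ω t => ν * (Torus.eGradNormSq (U ω t)).toReal with hΦd
  have hΦe_shift : ∀ ω t, 0 ≤ t → Φe (θ ω) t = Φe ω (t + 1) := by
    intro ω t ht; simp only [hΦe, hshift ω t ht]
  have hΦd_shift : ∀ ω t, 0 ≤ t → Φd (θ ω) t = Φd ω (t + 1) := by
    intro ω t ht; simp only [hΦd, hshift ω t ht]
  have hΦe0 : ∀ ω t, 0 ≤ Φe ω t := fun ω t => integral_nonneg fun _ => sq_nonneg _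
  have hΦd0 : ∀ ω t, 0 ≤ Φd ω t := fun ω t => mul_nonneg hν.le ENNReal.toReal_nonneg
  have hinte : ∀ᵐ ω ∂P, ∀ a b, 0 ≤ a → a ≤ b → IntervalIntegrable (Φe ω) volume a b := by
    filter_upwards [hLH] with ω ⟨u₀, hu⟩
    exact lerayHopf_intervalIntegrable_energy hu
  have hintd : ∀ᵐ ω ∂P, ∀ a b, 0 ≤ a → a ≤ b → IntervalIntegrable (Φd ω) volume a b := by
    filter_upwards [hLH] with ω ⟨u₀, hu⟩
    exact lerayHopf_intervalIntegrable_dissipation hu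
  -- Birkhoff along trajectories
  obtain ⟨estar, he_int, he_mean, he_ae⟩ := ae_tendsto_timeMean_of_measurePreserving P
    hθ hΦe_shift hΦe0 hinte hie
  obtain ⟨dstar, hd_int, hd_mean, hd_ae⟩ := ae_tendsto_timeMean_of_measurePreserving P
    hθ hΦd_shift hΦd0 hintd hid
  -- constants
  set F : ℝ := Real.sqrt (∫ x, ‖f x‖ ^ 2) with hF
  set E' : ℝ := (4 * F * E / ε) ^ 2 + 1 with hE'
  have hF0 : 0 ≤ F := Real.sqrt_nonneg _
  have hE'1 : 1 ≤ E' := by have := sq_nonneg (4 * F * E / ε); linarith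
  have hsE' : 0 < Real.sqrt E' := Real.sqrt_pos.2 (by linarith)
  set c : ℝ := F / Real.sqrt E' with hc
  have hc0 : 0 ≤ c := div_nonneg hF0 hsE'.le
  -- `c * E ≤ ε / 4`
  have hcE : c * E ≤ ε / 4 := by
    have h1 : 4 * F * E / ε ≤ Real.sqrt E' := le_sqrt_sq_add_one _
    have h2 : c * E = F * E / Real.sqrt E' := by rw [hc]; ring
    rw [h2, div_le_iff₀ hsE']
    calc F * E = ε / 4 * (4 * F * E / ε) := by field_simp
      _ ≤ ε / 4 * Real.sqrt E' := mul_le_mul_of_nonneg_left h1 (by positivity)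
  -- the good set: Leray–Hopf, and both Cesàro limits exist
  have hgood : ∀ᵐ ω ∂P, (∃ u₀ : 𝕋³ → E³, Torus.IsGlobalLerayHopf ν (fun _ => f) u₀ (U ω)) ∧
      Tendsto (timeMean (Φe ω)) atTop (𝓝 (estar ω)) ∧
      Tendsto (timeMean (Φd ω)) atTop (𝓝 (dstar ω)) := by
    filter_upwards [hLH, he_ae, hd_ae] with ω h1 h2 h3
    exact ⟨h1, h2, h3⟩
  -- on the good set the long-time means are `estar`, `dstar`, and `dstar ≤ F √estar`
  have hident : ∀ ω, ((∃ u₀ : 𝕋³ → E³, Torus.IsGlobalLerayHopf ν (fun _ => f) u₀ (U ω)) ∧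
      Tendsto (timeMean (Φe ω)) atTop (𝓝 (estar ω)) ∧
      Tendsto (timeMean (Φd ω)) atTop (𝓝 (dstar ω))) →
      meanEnergy (U ω) = estar ω ∧ meanDissipation ν (U ω) = dstar ω ∧
        0 ≤ estar ω ∧ dstar ω ≤ F * Real.sqrt (estar ω) := by
    rintro ω ⟨⟨u₀, hu⟩, h2, h3⟩
    have hEq : meanEnergy (U ω) = estar ω := by
      rw [meanEnergy_eq_longTimeAvgSup]; exact h2.limsup_eq
    have hDq : meanDissipation ν (U ω) = dstar ω := h3.limsup_eq
    refine ⟨hEq, hDq, hEq ▸ meanEnergy_nonneg (U ω), ?_⟩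
    rw [← hEq, ← hDq]
    exact lerayHopf_meanDissipation_le_norm_mul_sqrt_meanEnergy hν hf hmean hu
  -- the pathwise bound holds a.e., hence the selection function has large mean
  have hpath : ∀ᵐ ω ∂P, dstar ω ≤ F * Real.sqrt (estar ω) ∧ 0 ≤ estar ω := by
    filter_upwards [hgood] with ω hω
    exact ⟨(hident ω hω).2.2.2, (hident ω hω).2.2.1⟩
  have hnot : ¬ (∀ᵐ ω ∂P, dstar ω - c * estar ω ≤ ε / 2) := by
    intro hle
    have hint_h : Integrable (fun ω => dstar ω - c * estar ω) P := hd_int.sub (he_int.const_mul c)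
    have h1 : ∫ ω, (dstar ω - c * estar ω) ∂P ≤ ∫ _ω, ε / 2 ∂P :=
      integral_mono_ae hint_h (integrable_const _) hle
    have h2 : ∫ _ω, ε / 2 ∂P = ε / 2 := by simp
    have h3 : ∫ ω, (dstar ω - c * estar ω) ∂P = ∫ ω, dstar ω ∂P - c * ∫ ω, estar ω ∂P := by
      rw [integral_sub hd_int (he_int.const_mul c), integral_const_mul]
    have h4 : ε ≤ ∫ ω, dstar ω ∂P := by rw [hd_mean]; exact hεle
    have h5 : ∫ ω, estar ω ∂P ≤ E := by rw [he_mean]; exact hE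
    have h6 : c * ∫ ω, estar ω ∂P ≤ ε / 4 := (mul_le_mul_of_nonneg_left h5 hc0).trans hcE
    linarith
  -- pick a good trajectory where the selection function exceeds `ε / 2`
  obtain ⟨ω, hω, hsel⟩ : ∃ ω, ((∃ u₀ : 𝕋³ → E³, Torus.IsGlobalLerayHopf ν (fun _ => f) u₀ (U ω)) ∧
      Tendsto (timeMean (Φe ω)) atTop (𝓝 (estar ω)) ∧
      Tendsto (timeMean (Φd ω)) atTop (𝓝 (dstar ω))) ∧ ε / 2 < dstar ω - c * estar ω := by
    by_contra hcon
    refine hnot ?_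
    filter_upwards [hgood] with ω hω
    exact not_lt.1 fun hlt => hcon ⟨ω, hω, hlt⟩
  obtain ⟨hEq, hDq, he0, hpw⟩ := hident ω hω
  refine ⟨ω, hω.1, ?_, ?_⟩
  · -- energy bound: otherwise the pathwise cap contradicts the selection inequality
    rw [hEq]
    by_contra hlt'
    have hlt : (4 * F * E / ε) ^ 2 + 1 < estar ω := not_le.1 hlt'
    have hE'0 : 0 < estar ω := by linarith
    have hs : Real.sqrt E' ≤ Real.sqrt (estar ω) := Real.sqrt_le_sqrt hlt.le
    have h1 : estar ω / Real.sqrt (estar ω) ≤ estar ω / Real.sqrt E' :=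
      div_le_div_of_nonneg_left he0 hsE' hs
    rw [Real.div_sqrt] at h1
    have h2 : dstar ω ≤ c * estar ω := by
      calc dstar ω ≤ F * Real.sqrt (estar ω) := hpw
        _ ≤ F * (estar ω / Real.sqrt E') := mul_le_mul_of_nonneg_left h1 hF0
        _ = c * estar ω := by rw [hc]; ring
    have h3 : 0 ≤ c * estar ω := mul_nonneg hc0 he0
    linarith
  · rw [hDq]
    have h3 : 0 ≤ c * estar ω := mul_nonneg hc0 he0
    linarith

/-- **The ensemble zeroth law implies the zeroth law.**  ONE smooth, divergence-free, mean-zero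
steady force `f` on `T³`; viscosities `ν_j > 0`, `ν_j → 0`; for each `j` a shift-stationary
ensemble of Leray–Hopf trajectories of the Navier–Stokes equations with viscosity `ν_j` and force
`f` (a measure-preserving unit shift `θ_j` on a probability space, a shift-equivariant trajectory
map `U_j`, a.e. trajectory a global Leray–Hopf solution driven by `f`, integrable unit-window
energy and dissipation: the trajectory form of a stationary statistical solution) whose
ENSEMBLE-mean unit-window energy is `≤ E` and ENSEMBLE-mean unit-window dissipation is `≥ ε > 0`,
uniformly in `j`.  Then `AnomalousDissipation` holds: each ensemble contains a single
trajectory with `⟨‖u_j‖₂²⟩ ≤ (4‖f‖₂E/ε)² + 1` and `⟨ν_j‖∇u_j‖₂²⟩ ≥ ε/2`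
(`exists_trajectory_of_stationaryEnsemble`).  The statistical formulation of the zeroth law for a
fixed force is therefore not weaker than the summit. [folklore] -/
theorem anomalousDissipation_of_stationaryEnsembles {f : 𝕋³ → E³} (hf : Torus.IsSmooth f)
    (hdiv : Torus.IsDivFree f) (hmean : Torus.HasZeroMean f)
    {ν : ℕ → ℝ} (hν : ∀ j, 0 < ν j) (hν0 : Tendsto ν atTop (𝓝 0))
    {Ωj : ℕ → Type u} [∀ j, MeasurableSpace (Ωj j)] (P : ∀ j, Measure (Ωj j))
    [∀ j, IsProbabilityMeasure (P j)] {θ : ∀ j, Ωj j → Ωj j}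
    (hθ : ∀ j, MeasurePreserving (θ j) (P j) (P j)) (U : ∀ j, Ωj j → ℝ → 𝕋³ → E³)
    (hshift : ∀ j ω t, 0 ≤ t → U j (θ j ω) t = U j ω (t + 1))
    (hLH : ∀ j, ∀ᵐ ω ∂(P j), ∃ u₀ : 𝕋³ → E³, Torus.IsGlobalLerayHopf (ν j) (fun _ => f) u₀ (U j ω))
    (hie : ∀ j, Integrable (energyObs (U j)) (P j))
    (hid : ∀ j, Integrable (dissipationObs (ν j) (U j)) (P j))
    {E ε : ℝ} (hε : 0 < ε) (hE : ∀ j, ∫ ω, energyObs (U j) ω ∂(P j) ≤ E)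
    (hεle : ∀ j, ε ≤ ∫ ω, dissipationObs (ν j) (U j) ω ∂(P j)) :
    _root_.AnomalousDissipation := by
  have key : ∀ j, ∃ (u₀ : 𝕋³ → E³) (u : ℝ → 𝕋³ → E³),
      Torus.IsGlobalLerayHopf (ν j) (fun _ => f) u₀ u ∧
        meanEnergy u ≤ (4 * Real.sqrt (∫ x, ‖f x‖ ^ 2) * E / ε) ^ 2 + 1 ∧
        ε / 2 ≤ meanDissipation (ν j) u := by
    intro j
    obtain ⟨ω, ⟨u₀, hLH⟩, h1, h2⟩ :=
      exists_trajectory_of_stationaryEnsemble (hν j) hf hmean (hθ j) (hshift j) (hLH j) (hie j)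
        (hid j) hε (hE j) (hεle j)
    exact ⟨u₀, U j ω, hLH, h1, h2⟩
  choose u₀ u hLH hEn hD using key
  exact ⟨f, hf, hdiv, hmean, ν, u₀, u, hν, hν0, hLH, ⟨_, hEn⟩, ε / 2, by positivity, hD⟩

end Ensemble

end Summit.AnomalousDissipation.AnomalousDissipation.Theorems

end
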